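import Summits.QuantumFields.YangMills.Theses.ColdStartUniversality
import Literature.MathematicalPhysics.QuantumFieldTheory.Balaban1983to89.T4GenFunBounds
import Literature.MathematicalPhysics.QuantumFieldTheory.Balaban1983to89.T4ApexTwoLevel
import Literature.Barriers.QuantumFields.CenterSymmetryBreakingByQuarks
import HarnessLib

/-!
# Route `ColdStartUniversality`, crux K_A1|Γ `NeutralColdStartMixing` (stmt-QuantumFields-27363), LINE 7
# «valley_averaging»: THE CRUX ALREADY FOLLOWS FROM STUB 1 AND THE CENTRE-EVEN HALF OF STUB 2 — a kernel-checked
# composition in which `ValleyCesaroMixing` (27404) is asked only for TWIST-INVARIANT valley observables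

Helper file (seat `ym-line-csu-p1`, g14; `--supports stmt-QuantumFields-27363`).  Companion of
`…NeutralColdStartMixingValleyChargedSector` (p720043: stub 2 AS TYPED implies the cut-off-uniform decay of the SIGNED
Polyakov line — the charged-sector relaxation that rev 3 removed from the crux).  Here the constructive half: the
registered composition `NeutralColdStartMixing_of` of line «valley_averaging» only ever applies stub 2 to
`h = vproj_K(os) = E_Gibbs[∏_{C∈os} avgObs K C | valley σ-algebra]` for a CENTRE-EVEN string `os`, and that `h` is
invariant, Gibbs-a.e., under the fine 't Hooft twist `ctwist (−1) μ' s₀` of every direction (`s₀` = the slice of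
`T3CentreSymmetry.exists_ctwist_avgObs`): the Gibbs measure, the string and the valley σ-algebra are all twist-invariant,
and conditional expectations commute with measure-preserving symmetries of the conditioning σ-algebra.  Hence:

* `condExp_comp_ae_eq_of_measurePreserving` — for a finite measure `μ`, a sub-σ-algebra `m`, an `m`-measurable
  `μ`-preserving measurable involution `e` and an integrable `f` with `f ∘ e = f`: `μ[f|m] ∘ e = μ[f|m]` a.e. [folklore];
* `measurePreserving_ctwist_gibbsMeasure` — the step-`K` Wilson–Gibbs measure is twist-invariant (as a measure);
  `wind_polyakov_eq` — the valley coordinate flips the sign of exactly its `μ'`-component under the `μ'`-twist at `s₀`;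
* ★ `neutralColdStartMixing_of_tracking_of_evenValleyMixing` —
  `AdiabaticValleyTracking → ValleyCesaroMixingEven → NeutralColdStartMixing`, where `ValleyCesaroMixingEven` is item
  27404 VERBATIM with ONE EXTRA HYPOTHESIS on the test function `h`: `∀ μ', ∃ s, h ∘ ctwist (−1) μ' s = h` Gibbs-a.e.
  (spelled inline; no new definition).  So the planner may weaken stub 2 to centre-even valley observables — immune to
  the signed-Polyakov kill-shape — without touching stub 1 or the composition.

THEOREMS ONLY; custody information for the planner / critic.  RECORD-rung R3 plumbing: no crux, rung or summit statement
is proved here and the Yang–Mills mass gap is NOT proved.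
-/

set_option autoImplicit false

noncomputable section

namespace Summit.QuantumFields.YangMills.Theorems.ColdStartUniversality

open MeasureTheory
open scoped NNReal
open Literature.MathematicalPhysics.QuantumFieldTheory
open Literature.MathematicalPhysics.QuantumLattice (fundamentalRep continuous_fundamentalRep)
open Literature.MathematicalPhysics.QuantumFieldTheory.Balaban1983to89
open Literature.MathematicalPhysics.QuantumFieldTheory.Balaban1983to89.T3ContinuumYM3Torus (negOne₂ negOne₂_comm
  negOne₂_mul_self reTr_negOne₂_mul)

/-! ## §1 Conditional expectations commute with symmetries of the conditioning σ-algebra -/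

/-- **Conditional expectation is invariant under a measure-preserving, `m`-measurable involution fixing the integrand**:
`μ[f|m] (e x) = μ[f|m] x` for `μ`-a.e. `x` (uniqueness of the conditional expectation: `μ[f|m] ∘ e` is `m`-measurable and
has the right integrals on `m`-sets, by the change of variables `x ↦ e x`). [folklore] -/
theorem condExp_comp_ae_eq_of_measurePreserving {α : Type*} {m m₀ : MeasurableSpace α} {μ : Measure α}
    [IsFiniteMeasure μ] (hm : m ≤ m₀) (e : α ≃ᵐ α) (hμe : MeasurePreserving e μ μ)
    (hem : Measurable[m, m] e) (he2 : ∀ x, e (e x) = x) {f : α → ℝ} (hf : Integrable f μ)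
    (hfe : ∀ x, f (e x) = f x) :
    (fun x => (μ[f|m]) (e x)) =ᵐ[μ] μ[f|m] := by
  refine ae_eq_condExp_of_forall_setIntegral_eq hm hf (fun s _ _ => ?_) (fun s hs _ => ?_) ?_
  · exact ((hμe.integrable_comp_emb e.measurableEmbedding).2 integrable_condExp).integrableOn
  · have hs' : MeasurableSet[m] (e ⁻¹' s) := hem hs
    have hpre : (e : α → α) ⁻¹' ((e : α → α) ⁻¹' s) = s := by
      ext x
      simp only [Set.mem_preimage, he2]
    calc ∫ x in s, (μ[f|m]) (e x) ∂μ = ∫ x in (e : α → α) ⁻¹' ((e : α → α) ⁻¹' s), (μ[f|m]) (e x) ∂μ := by rw [hpre]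
      _ = ∫ y in (e : α → α) ⁻¹' s, (μ[f|m]) y ∂μ := hμe.setIntegral_preimage_emb e.measurableEmbedding _ _
      _ = ∫ y in (e : α → α) ⁻¹' s, f y ∂μ := setIntegral_condExp hm hf hs'
      _ = ∫ x in (e : α → α) ⁻¹' ((e : α → α) ⁻¹' s), f (e x) ∂μ :=
          (hμe.setIntegral_preimage_emb e.measurableEmbedding _ _).symm
      _ = ∫ x in s, f x ∂μ := by
          rw [hpre]
          exact setIntegral_congr_fun (hm _ hs) fun x _ => hfe x
  · exact (stronglyMeasurable_condExp.comp_measurable hem).aestronglyMeasurable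

/-! ## §2 The twist preserves the Gibbs measure and flips the valley coordinate -/

/-- **The step-`K` Wilson–Gibbs measure is invariant under every central twist** (product Haar measure and Boltzmann
weight are; 't Hooft). [cite: tHooft1979Flux, §2] -/
theorem measurePreserving_ctwist_gibbsMeasure {G : Type*} [GaugeGroup G] [MeasurableSpace G] [RegularGaugeGroup G]
    [HaarData G] [MeasurableMul G] {z : G} (hz : ∀ g : G, z * g = g * z) (P : Params) (β : ℝ) (μ : Fin P.d)
    (s : ZMod (P.sitesPerDir 0)) :
    MeasurePreserving (GaugeField.ctwist z μ s) (T4GenFunBounds.gibbsMeasure (G := G) P β)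
      (T4GenFunBounds.gibbsMeasure (G := G) P β) := by
  refine ⟨(GaugeField.measurePreserving_ctwist z μ s).measurable, ?_⟩
  have hmap : ((fieldMeasure P 0 G).withDensity fun U => ENNReal.ofReal (Missing.boltzmann P β U)).map
      (GaugeField.ctwistMEquiv (P := P) (j := 0) z μ s) =
      (fieldMeasure P 0 G).withDensity fun U => ENNReal.ofReal (Missing.boltzmann P β U) :=
    Literature.Barriers.QuantumFields.map_withDensity_of_invariant _ _ (GaugeField.measurePreserving_ctwist z μ s).map_eq _
      (T4GenFunBounds.measurable_ofReal_boltzmann P β) fun U => by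
        show ENNReal.ofReal (Missing.boltzmann P β (GaugeField.ctwist z μ s U)) = _
        rw [Missing.boltzmann_ctwist hz]
  rw [T4GenFunBounds.gibbsMeasure, Measure.map_smul]
  exact congrArg _ hmap

/-- The straight Polyakov label in direction `ν` winds `[ν = μ]` times around the `μ`-period. [cite: McLerranSvetitsky1981] -/
theorem wind_polyakov_eq (F : T3ContinuumYM3Torus.T3Family) (μ ν : Fin 3) (x : F.USite) :
    (T3ContinuumYM3Torus.ULoop3.polyakov ν x).wind μ = if ν = μ then 1 else 0 := by
  by_cases h : ν = μ
  · subst h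
    rw [if_pos rfl]
    exact T3ContinuumYM3Torus.ULoop3.wind_polyakov ν x
  · rw [if_neg h, T3ContinuumYM3Torus.ULoop3.wind]
    show T4Continuum.netDisp (List.replicate (2 * F.L ^ F.m) (ν, true)) μ / ((2 * F.L ^ F.m : ℕ) : ℤ) = 0
    rw [T4ReflectionCone.netDisp_replicate]
    simp [h]

/-- Products of signed factors: `∏ (ε_C x_C) = (−1)^{Σ w_C} ∏ x_C`. [folklore] -/
theorem prod_map_negOnePow_mul'' {F : T3ContinuumYM3Torus.T3Family} (w : T3ContinuumYM3Torus.ULoop3 F → ℤ)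
    (x : T3ContinuumYM3Torus.ULoop3 F → ℝ) :
    ∀ Cs : List (T3ContinuumYM3Torus.ULoop3 F),
      (Cs.map fun C => (-1 : ℝ) ^ w C * x C).prod = (-1 : ℝ) ^ (Cs.map w).sum * (Cs.map x).prod
  | [] => by simp
  | C :: Cs => by
    rw [List.map_cons, List.prod_cons, prod_map_negOnePow_mul'' w x Cs, List.map_cons, List.sum_cons, List.map_cons,
      List.prod_cons, zpow_add₀ (by norm_num : (-1 : ℝ) ≠ 0)]
    ring

/-! ## §3 The composition with the centre-even half of stub 2 -/

/-- |∏ of numbers in [-1,1]| ≤ 1. [folklore] -/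
theorem abs_prod_map_le_one' {α : Type*} (f : α → ℝ) (hf : ∀ a, |f a| ≤ 1) (l : List α) : |(l.map f).prod| ≤ 1 := by
  induction l with
  | nil => simp
  | cons a l ih =>
    rw [List.map_cons, List.prod_cons, abs_mul]
    exact mul_le_one₀ (hf a) (abs_nonneg _) ih

/-- ★★ **K_A1|Γ FROM STUB 1 AND THE CENTRE-EVEN HALF OF STUB 2.**  `AdiabaticValleyTracking` (item 27403) and
`ValleyCesaroMixing` RESTRICTED TO TWIST-INVARIANT VALLEY OBSERVABLES (item 27404 verbatim with the extra hypothesis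
`∀ μ', ∃ s, h (ctwist (−1) μ' s V) = h V` for Gibbs-a.e. `V`) imply `NeutralColdStartMixing`.  Proof = the registered
composition of line «valley_averaging» (tower property of the valley projection + ε/3) plus the discharge of the extra
hypothesis for `h = E_Gibbs[∏_{C∈os} avgObs K C | valley]`, `os` centre-even: twist-invariance of the Gibbs measure
(`measurePreserving_ctwist_gibbsMeasure`), of the string (`T3CentreSymmetry.exists_ctwist_avgObs` + evenness) and of the
valley σ-algebra (the twist flips one valley coordinate), and `condExp_comp_ae_eq_of_measurePreserving`. [cite: tHooft1979Flux, §2] -/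
theorem neutralColdStartMixing_of_tracking_of_evenValleyMixing
    (h1 : Summit.QuantumFields.YangMills.Theses.ColdStartUniversality.AdiabaticValleyTracking)
    (h2 : ∃ γ₁ : ℝ, 0 < γ₁ ∧ ∀ (F : Literature.MathematicalPhysics.QuantumFieldTheory.Balaban1983to89.T3ContinuumYM3Torus.T3Family) (γ : ℝ), 0 < γ → γ ≤ γ₁ → ∀ (δ : ℝ), 0 < δ → ∃ T₀ : ℝ, 0 < T₀ ∧ ∃ K₀ : ℕ, ∀ K : ℕ, K₀ ≤ K → ∀ (h : Literature.MathematicalPhysics.QuantumFieldTheory.Balaban1983to89.GaugeField (F.P K) 0 (Matrix.specialUnitaryGroup (Fin 2) ℂ) → ℝ), @MeasureTheory.StronglyMeasurable _ _ _ (MeasurableSpace.comap (fun (V : Literature.MathematicalPhysics.QuantumFieldTheory.Balaban1983to89.GaugeField (F.P K) 0 (Matrix.specialUnitaryGroup (Fin 2) ℂ)) (μ : Fin 3) => (Fintype.card F.USite : ℝ)⁻¹ * ∑ x : F.USite, F.avgObs (Literature.MathematicalPhysics.QuantumFieldTheory.Balaban1983to89.ExpMeanLog.expMeanLogSU : Literature.MathematicalPhysics.QuantumFieldTheory.Balaban1983to89.LoopAverage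 (Matrix.specialUnitaryGroup (Fin 2) ℂ)) K (Literature.MathematicalPhysics.QuantumFieldTheory.Balaban1983to89.T3ContinuumYM3Torus.ULoop3.polyakov μ x) V) MeasurableSpace.pi) h → (∀ᵐ V ∂(Literature.MathematicalPhysics.QuantumFieldTheory.Balaban1983to89.T4GenFunBounds.gibbsMeasure (G := Matrix.specialUnitaryGroup (Fin 2) ℂ) (F.P K) ((F.scheme (Literature.MathematicalPhysics.QuantumFieldTheory.Balaban1983to89.ExpMeanLog.expMeanLogSU : Literature.MathematicalPhysics.QuantumFieldTheory.Balaban1983to89.LoopAverage (Matrix.specialUnitaryGroup (Fin 2) ℂ)) γ).β K)), |h V| ≤ 1) →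
      -- THE EXTRA HYPOTHESIS (centre-even test functions only):
      (∀ μ' : Fin 3, ∃ s : ZMod ((F.P K).sitesPerDir 0), ∀ᵐ V ∂(Literature.MathematicalPhysics.QuantumFieldTheory.Balaban1983to89.T4GenFunBounds.gibbsMeasure (G := Matrix.specialUnitaryGroup (Fin 2) ℂ) (F.P K) ((F.scheme (Literature.MathematicalPhysics.QuantumFieldTheory.Balaban1983to89.ExpMeanLog.expMeanLogSU : Literature.MathematicalPhysics.QuantumFieldTheory.Balaban1983to89.LoopAverage (Matrix.specialUnitaryGroup (Fin 2) ℂ)) γ).β K)), h (Literature.MathematicalPhysics.QuantumFieldTheory.Balaban1983to89.GaugeField.ctwist negOne₂ μ' s V) = h V) →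
      ∀ (Ω : Type) (mΩ : MeasurableSpace Ω) (P : MeasureTheory.Measure Ω) (hP : MeasureTheory.IsProbabilityMeasure P) (W : NNReal → Ω → (Literature.MathematicalPhysics.QuantumFieldTheory.Edge 3 ((F.P K).sitesPerDir 0) × Literature.MathematicalPhysics.QuantumFieldTheory.NoiseIdx 2 → ℝ)) (hW : Literature.MathematicalPhysics.QuantumFieldTheory.IsFlatBrownian W P) (U : NNReal → Ω → Literature.MathematicalPhysics.QuantumFieldTheory.GaugeConfig 3 ((F.P K).sitesPerDir 0) (Matrix.specialUnitaryGroup (Fin 2) ℂ)), (∀ ω, U 0 ω = fun _ => 1) → (Literature.MathematicalPhysics.QuantumFieldTheory.latticeLangevinDynamics (⟨2, Literature.MathematicalPhysics.QuantumLattice.fundamentalRep (Fin 2), Literature.MathematicalPhysics.QuantumLattice.continuous_fundamentalRep _, Literature.MathematicalPhysics.QuantumLattice.fundamentalRep_injective _, Literature.MathematicalPhysics.QuantumLattice.fundamentalRep_mem_unitaryGroup⟩ : Literature.MathematicalPhysics.QuantumFieldTheory.LatticeRep (Matrix.specialUnitaryGroup (Fin 2) ℂ)) ((γ * (F.P K).eps)⁻¹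 / 2)).IsSolution (Literature.MathematicalPhysics.QuantumLattice.fundamentalRep (Fin 2)) hW.natFiltration P W U → ∀ (T : ℝ), T₀ ≤ T → |∫ V, h V ∂(Literature.MathematicalPhysics.QuantumFieldTheory.Balaban1983to89.T4GenFunBounds.gibbsMeasure (G := Matrix.specialUnitaryGroup (Fin 2) ℂ) (F.P K) ((F.scheme (Literature.MathematicalPhysics.QuantumFieldTheory.Balaban1983to89.ExpMeanLog.expMeanLogSU : Literature.MathematicalPhysics.QuantumFieldTheory.Balaban1983to89.LoopAverage (Matrix.specialUnitaryGroup (Fin 2) ℂ)) γ).β K)) - T⁻¹ * intervalIntegral (fun s : ℝ => MeasureTheory.integral P (fun ω => h (fun b : Literature.MathematicalPhysics.QuantumFieldTheory.Balaban1983to89.PBond (F.P K) 0 => U (s / (F.P K).eps).toNNReal ω (b.src, b.dir)))) 0 T MeasureTheory.volume| ≤ δ) :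
    Summit.QuantumFields.YangMills.Theses.ColdStartUniversality.NeutralColdStartMixing := by
  obtain ⟨γa, hγa, ha⟩ := h1
  obtain ⟨γb, hγb, hb⟩ := h2
  refine ⟨min γa γb, lt_min hγa hγb, fun F γ hγ hγle os hos δ hδ => ?_⟩
  obtain ⟨c, hc, K₁, hK₁⟩ := ha F γ hγ (hγle.trans (min_le_left _ _)) os hos (δ / 3) (by positivity)
  obtain ⟨T₀, hT₀, K₂, hK₂⟩ := hb F γ hγ (hγle.trans (min_le_right _ _)) (δ / 3) (by positivity)
  set T : ℝ := max T₀ (3 * c / δ + 1) with hT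
  have hTpos : 0 < T := lt_max_of_lt_left hT₀
  have hT₀le : T₀ ≤ T := le_max_left _ _
  have hcT : c / T ≤ δ / 3 := by
    have h3 : 3 * c / δ + 1 ≤ T := le_max_right _ _
    rw [div_le_iff₀ hTpos]
    calc c = δ / 3 * (3 * c / δ) := by field_simp
      _ ≤ δ / 3 * (3 * c / δ + 1) := by gcongr; linarith
      _ ≤ δ / 3 * T := by gcongr
  refine ⟨T, hTpos, max K₁ K₂, fun K hK Ω mΩ P hP W hW U hU0 hUsol => ?_⟩
  -- the level-K objects
  set ℰ : LoopAverage (Matrix.specialUnitaryGroup (Fin 2) ℂ) := ExpMeanLog.expMeanLogSU with hℰ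
  set μ0 := T4GenFunBounds.gibbsMeasure (G := Matrix.specialUnitaryGroup (Fin 2) ℂ) (F.P K) ((F.scheme ℰ γ).β K) with hμ0
  haveI : IsProbabilityMeasure μ0 :=
    T4GenFunBounds.isProbabilityMeasure_gibbsMeasure (G := Matrix.specialUnitaryGroup (Fin 2) ℂ) (F.P K) (F.scheme_β_nonneg ℰ hγ.le K)
  set θ : GaugeField (F.P K) 0 (Matrix.specialUnitaryGroup (Fin 2) ℂ) → (Fin 3 → ℝ) := fun V μ =>
    (Fintype.card F.USite : ℝ)⁻¹ * ∑ x : F.USite, F.avgObs ℰ K (T3ContinuumYM3Torus.ULoop3.polyakov μ x) V with hθ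
  set fstr : GaugeField (F.P K) 0 (Matrix.specialUnitaryGroup (Fin 2) ℂ) → ℝ := fun V =>
    (os.map fun C => F.avgObs ℰ K C V).prod with hfstr
  set vproj : GaugeField (F.P K) 0 (Matrix.specialUnitaryGroup (Fin 2) ℂ) → ℝ :=
    MeasureTheory.condExp (MeasurableSpace.comap θ MeasurableSpace.pi) μ0 fstr with hvproj
  have hAvg : F.AvgMeasurable ℰ := F.avgMeasurable_of_measurableE ℰ T4ApexTwoLevel.measurableE_expMeanLogSU
  have hθm : Measurable θ := by
    refine measurable_pi_lambda _ fun μ => ?_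
    exact (Finset.measurable_sum _ fun x _ => F.measurable_avgObs hAvg K _).const_mul _
  have hm : MeasurableSpace.comap θ MeasurableSpace.pi ≤
      (inferInstance : MeasurableSpace (GaugeField (F.P K) 0 (Matrix.specialUnitaryGroup (Fin 2) ℂ))) := hθm.comap_le
  have hSM : @StronglyMeasurable _ _ _ (MeasurableSpace.comap θ MeasurableSpace.pi) vproj := stronglyMeasurable_condExp
  have hfbd : ∀ V, |fstr V| ≤ 1 := fun V =>
    abs_prod_map_le_one' (fun C => F.avgObs ℰ K C V) (fun C => F.abs_avgObs_le_one ℰ K C V) os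
  have hfm : Measurable fstr :=
    T4GenFunBounds.measurable_prodObs (F.scheme ℰ γ) (fun K' C => F.measurable_avgObs hAvg K' C) K os
  have hfint : Integrable fstr μ0 :=
    Integrable.mono' (integrable_const (1 : ℝ)) hfm.aestronglyMeasurable
      (ae_of_all _ fun V => by rw [Real.norm_eq_abs]; exact hfbd V)
  have hbd : ∀ᵐ V ∂μ0, |vproj V| ≤ 1 :=
    ae_bdd_abs_condExp_of_ae_bdd_abs (m := MeasurableSpace.comap θ MeasurableSpace.pi) (μ := μ0) (R := (1 : ℝ))
      (f := fstr) (Filter.Eventually.of_forall hfbd)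
  -- ★ the extra hypothesis: `vproj` is twist-invariant a.e., direction by direction
  have hEven : ∀ μ' : Fin 3, ∃ s : ZMod ((F.P K).sitesPerDir 0), ∀ᵐ V ∂μ0,
      vproj (GaugeField.ctwist negOne₂ μ' s V) = vproj V := by
    intro μ'
    obtain ⟨s₀, h₀⟩ := T3ContinuumYM3Torus.exists_ctwist_avgObs F ℰ negOne₂_comm negOne₂_mul_self reTr_negOne₂_mul μ' K
    refine ⟨s₀, ?_⟩
    -- the twist as an involutive measurable equivalence preserving `μ0`
    have hinv : (negOne₂ : Matrix.specialUnitaryGroup (Fin 2) ℂ)⁻¹ = negOne₂ :=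
      inv_eq_of_mul_eq_one_right negOne₂_mul_self
    set e : GaugeField (F.P K) 0 (Matrix.specialUnitaryGroup (Fin 2) ℂ) ≃ᵐ
        GaugeField (F.P K) 0 (Matrix.specialUnitaryGroup (Fin 2) ℂ) := GaugeField.ctwistMEquiv negOne₂ μ' s₀ with he
    have he_apply : ∀ V, e V = GaugeField.ctwist negOne₂ μ' s₀ V := fun V => rfl
    have he2 : ∀ V, e (e V) = V := fun V => by
      rw [he_apply, he_apply]
      have h := GaugeField.ctwist_inv_ctwist (P := F.P K) (j := 0) negOne₂ μ' s₀ V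
      rwa [hinv] at h
    have hμe : MeasurePreserving e μ0 μ0 :=
      measurePreserving_ctwist_gibbsMeasure negOne₂_comm (F.P K) ((F.scheme ℰ γ).β K) μ' s₀
    -- the string is twist-invariant (centre-even)
    have hfe : ∀ V, fstr (e V) = fstr V := fun V => by
      rw [he_apply]
      show (os.map fun C => F.avgObs ℰ K C (GaugeField.ctwist negOne₂ μ' s₀ V)).prod = (os.map fun C => F.avgObs ℰ K C V).prod
      simp_rw [h₀]
      rw [prod_map_negOnePow_mul'' (fun C => C.wind μ') (fun C => F.avgObs ℰ K C V) os, (hos μ').neg_one_zpow, one_mul]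
    -- the valley coordinate flips its `μ'`-component: `θ ∘ e = flip ∘ θ`
    have hθe : θ ∘ e = (fun v : Fin 3 → ℝ => fun ν => (-1 : ℝ) ^ (if ν = μ' then (1 : ℤ) else 0) * v ν) ∘ θ := by
      funext V ν
      simp only [Function.comp_apply, hθ, he_apply]
      have hx : ∀ x : F.USite,
          F.avgObs ℰ K (T3ContinuumYM3Torus.ULoop3.polyakov ν x) (GaugeField.ctwist negOne₂ μ' s₀ V) =
            (-1 : ℝ) ^ (if ν = μ' then (1 : ℤ) else 0) * F.avgObs ℰ K (T3ContinuumYM3Torus.ULoop3.polyakov ν x) V :=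
        fun x => by rw [h₀, wind_polyakov_eq F μ' ν x]
      simp_rw [hx]
      rw [← Finset.mul_sum]
      ring
    have hflip : Measurable (fun v : Fin 3 → ℝ => fun ν => (-1 : ℝ) ^ (if ν = μ' then (1 : ℤ) else 0) * v ν) :=
      measurable_pi_lambda _ fun ν => (measurable_pi_apply ν).const_mul _
    have hem : Measurable[MeasurableSpace.comap θ MeasurableSpace.pi, MeasurableSpace.comap θ MeasurableSpace.pi] e := by
      rw [measurable_iff_comap_le, MeasurableSpace.comap_comp, hθe, ← MeasurableSpace.comap_comp]
      exact MeasurableSpace.comap_mono hflip.comap_le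
    have key := condExp_comp_ae_eq_of_measurePreserving (μ := μ0) hm e hμe hem he2 hfint hfe
    filter_upwards [key] with V hV
    rw [← he_apply]
    exact hV
  have hint : ∫ V, vproj V ∂μ0 = (F.scheme ℰ γ).expectAt K os := by
    rw [hvproj, integral_condExp hm]
    exact (T4GenFunBounds.expectAt_eq_integral_gibbs _ (F.scheme_β_nonneg ℰ hγ.le) K os).symm
  have h1' := hK₁ K (le_of_max_le_left hK) Ω mΩ P hP W hW U hU0 hUsol T hTpos
  have h2' := hK₂ K (le_of_max_le_right hK) vproj hSM hbd hEven Ω mΩ P hP W hW U hU0 hUsol T hT₀le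
  rw [hint] at h2'
  -- names for the two time integrals
  set Ih : ℝ := intervalIntegral (fun s : ℝ => MeasureTheory.integral P (fun ω =>
      vproj (fun b : PBond (F.P K) 0 => U (s / (F.P K).eps).toNNReal ω (b.src, b.dir)))) 0 T volume with hIh
  set If : ℝ := intervalIntegral (fun s : ℝ => MeasureTheory.integral P (fun ω =>
      (os.map fun C => F.avgObs ℰ K C (fun b : PBond (F.P K) 0 => U (s / (F.P K).eps).toNNReal ω (b.src, b.dir))).prod))
      0 T volume with hIf
  have hTinv : 0 < T⁻¹ := inv_pos.mpr hTpos
  have hthird : |T⁻¹ * Ih - T⁻¹ * If| ≤ δ / 3 + c / T := by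
    rw [← mul_sub, abs_mul, abs_of_pos hTinv]
    calc T⁻¹ * |Ih - If| ≤ T⁻¹ * (δ / 3 * T + c) := by gcongr
      _ = δ / 3 + c / T := by field_simp
  calc |(F.scheme ℰ γ).expectAt K os - T⁻¹ * If|
      ≤ |(F.scheme ℰ γ).expectAt K os - T⁻¹ * Ih| + |T⁻¹ * Ih - T⁻¹ * If| := abs_sub_le _ _ _
    _ ≤ δ / 3 + (δ / 3 + c / T) := add_le_add h2' hthird
    _ ≤ δ := by linarith

end Summit.QuantumFields.YangMills.Theorems.ColdStartUniversality

end
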